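import Mathlib.MeasureTheory.Integral.IntervalIntegral.FundThmCalculus
import Literature.Analysis.FluidPDE.EulerReynolds
import Literature.Analysis.FluidPDE.ClassicalOpenStripEnergy
import HarnessLib

/-!
# Tested (weak) forms of the Euler–Reynolds momentum equation with pressure and of the relaxed
# local energy equality (De Lellis–Kwon 2022, Def. 2.1, §2.2)

Support file (theorem-only) for the named fact `Torus.DeLellisKwon2022_thm11`
(`GloballyDissipativeEuler`). A *dissipative Euler–Reynolds flow* (De Lellis–Kwon, Anal. PDE 15
(2022) = arXiv:2006.06482, Def. 2.1, after Isett 2022) is a smooth tuple `(v, p, R, κ, φ)` with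
an energy loss `E(t)` solving pointwise `∂ₜv + ∇·(v ⊗ v) + ∇p = ∇·R`, `∇·v = 0`,
`∂ₜ(½|v|²) + ∇·((½|v|² + p) v) = Dₜ(κ + E/2) + ∇·(R v) + ∇·φ`, `Dₜ = ∂ₜ + v·∇`. The passage
to the limit of §2.2 uses each approximant only through the identities obtained by testing these
equations against smooth test functions compactly supported in `(0,T)` and integrating by parts
on `[0,T] × T^d`; they are proved here from the pointwise equations on a time set `S ⊇ [0,T]`:

* `Torus.momentum_testedIdentity` — for every smooth vector test `ψ`,
  `∫₀ᵀ∫ (⟪v, ∂ₜψ⟫ + ⟪v, (v·∇)ψ⟫ + p div ψ) = ∫₀ᵀ∫ ∑ⱼ ⟪R^{(j)}, ∂ⱼψ⟫`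
  (pressure-explicit companion of the tree's `Torus.IsEulerReynoldsOn.weak_identity`);
* `Torus.localEnergy_testedIdentity` — for every smooth scalar test `ψ`,
  `∫₀ᵀ∫ (½|v|² ∂ₜψ + (½|v|² + p)⟪v, ∇ψ⟫) = ∫₀ᵀ∫ (κ ∂ₜψ + κ⟪v, ∇ψ⟫ - ½E' ψ + ⟪R v, ∇ψ⟫ + ⟪φ, ∇ψ⟫)`.

These are the hypotheses `hmom`, `hener` (with `D = -E'/2`) of
`Torus.isGloballyDissipativeEulerOn_of_unifLimit` (`GloballyDissipativeEulerLimit`).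

## References

* C. De Lellis, H. Kwon, Anal. PDE 15 (2022) 2003–2059 = arXiv:2006.06482, Def. 2.1, §2.2.
  [DelellisKwon2022]
* P. Isett, Arch. Ration. Mech. Anal. 244 (2022) = arXiv:1710.11186, §1.
-/
noncomputable section

open MeasureTheory Set Filter Function
open scoped InnerProductSpace RealInnerProductSpace ENNReal NNReal Topology ContDiff

namespace Literature.Analysis.FluidPDE.Torus

variable {d : Type*} [Fintype d] [DecidableEq d]

/-! ### The momentum equation with pressure, tested -/

/-- **Tested momentum equation with pressure and Reynolds defect** (De Lellis–Kwon 2022, §2.2;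
integration by parts of the first equation of Def. 2.1). Let `v, p, R` be jointly smooth on
`S × T^d`, `S ⊇ [0,T]`, `0 < T`, with `∂ₜv + (v·∇)v + ∇p = div R` and `div v = 0` pointwise on
`S`. Then for every smooth vector test field `ψ` compactly supported in time in `(0,T)`,
`∫₀ᵀ∫ (⟪v, ∂ₜψ⟫ + ⟪v, (v·∇)ψ⟫ + p div ψ) = ∫₀ᵀ∫ ∑ⱼ ⟪R^{(j)}, ∂ⱼψ⟫`.
Proof: `e(t) = ∫⟪v(t), ψ(t)⟫` vanishes at `t = 0, T`, `e' = ∫ ⟪v, ∂ₜψ⟫ + ⟪div R - ∇p - (v·∇)v, ψ⟫`,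
and on the torus `∫⟪∇p, ψ⟫ = -∫ p div ψ`, `∫⟪(v·∇)v, ψ⟫ = -∫⟪v, (v·∇)ψ⟫` (`div v = 0`),
`∫⟪div R, ψ⟫ = -∫ ∑ⱼ ⟪R^{(j)}, ∂ⱼψ⟫`. [cite: DelellisKwon2022, Def. 2.1 and §2.2] -/
theorem momentum_testedIdentity {S : Set ℝ} {T : ℝ} (hT : 0 < T) (hS : Icc 0 T ⊆ S)
    {v : ℝ → UnitAddTorus d → EuclideanSpace ℝ d} {p : ℝ → UnitAddTorus d → ℝ}
    {R : ℝ → UnitAddTorus d → d → EuclideanSpace ℝ d}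
    (hv : FunctionSpaces.Torus.IsSmoothSpaceTimeOn S v) (hp : FunctionSpaces.Torus.IsSmoothSpaceTimeOn S p) (hR : FunctionSpaces.Torus.IsSmoothSpaceTimeOn S R)
    (hmom : ∀ t ∈ S, ∀ x, FunctionSpaces.Torus.timeDerivWithin S v t x + FunctionSpaces.Torus.convect (v t) (v t) x + FunctionSpaces.Torus.gradient (p t) x =
      tensorDivergence (R t) x)
    (hdiv : ∀ t ∈ S, FunctionSpaces.Torus.IsDivFree (v t))
    {ψ : ℝ → UnitAddTorus d → EuclideanSpace ℝ d} (hψ : FunctionSpaces.Torus.IsSpaceTimeTestIoo T ψ) :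
    ∫ t in Ioo 0 T, ∫ x, (⟪v t x, FunctionSpaces.Torus.timeDeriv ψ t x⟫_ℝ + ⟪v t x, FunctionSpaces.Torus.convect (v t) (ψ t) x⟫_ℝ +
        p t x * FunctionSpaces.Torus.divergence (ψ t) x) =
      ∫ t in Ioo 0 T, ∫ x, ∑ j, ⟪R t x j, FunctionSpaces.Torus.partialDeriv j (ψ t) x⟫_ℝ := by
  obtain ⟨⟨hψs, T', hT'T, hT'⟩, ε, hε, hε0⟩ := id hψ
  set I : Set ℝ := Icc 0 T with hI_def
  have hU : UniqueDiffOn ℝ I := uniqueDiffOn_Icc hT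
  have hvI : FunctionSpaces.Torus.IsSmoothSpaceTimeOn I v := hv.mono hS
  have hpI : FunctionSpaces.Torus.IsSmoothSpaceTimeOn I p := hp.mono hS
  have hRI : FunctionSpaces.Torus.IsSmoothSpaceTimeOn I R := hR.mono hS
  have hψI : FunctionSpaces.Torus.IsSmoothSpaceTimeOn I ψ := hψs.contDiffOn
  have hψ'I : FunctionSpaces.Torus.IsSmoothSpaceTimeOn I (FunctionSpaces.Torus.timeDeriv ψ) := hψ.1.timeDeriv.1.contDiffOn
  -- the momentum equation with the time derivative taken within `I`
  have hmomI : ∀ t ∈ I, ∀ x, FunctionSpaces.Torus.timeDerivWithin I v t x =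
      tensorDivergence (R t) x - FunctionSpaces.Torus.gradient (p t) x - FunctionSpaces.Torus.convect (v t) (v t) x := by
    intro t ht x
    have h1 : FunctionSpaces.Torus.timeDerivWithin I v t x = FunctionSpaces.Torus.timeDerivWithin S v t x :=
      ((hv.hasDerivWithinAt_slice (hS ht) x).mono hS).derivWithin (hU t ht)
    rw [h1, ← hmom t (hS ht) x]; abel
  -- the pairing `e(t) = ∫ ⟪v(t), ψ(t)⟫` and its derivative within `I`
  have hg : FunctionSpaces.Torus.IsSmoothSpaceTimeOn I (fun t x => ⟪v t x, ψ t x⟫_ℝ) := hvI.inner hψI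
  set e : ℝ → ℝ := fun t => ∫ x, ⟪v t x, ψ t x⟫_ℝ with he_def
  set e' : ℝ → ℝ := fun t => ∫ x, FunctionSpaces.Torus.timeDerivWithin I (fun t x => ⟪v t x, ψ t x⟫_ℝ) t x
    with he'_def
  have he : ∀ t ∈ I, HasDerivWithinAt e (e' t) I t := fun t ht =>
    hg.hasDerivWithinAt_integral (convex_Icc 0 T) ht
  have he'cont : ContinuousOn e' I := hg.continuousOn_integral_timeDerivWithin hU
  have he0 : e 0 = 0 := by
    simp only [he_def, hε0 0 hε.le, Pi.zero_apply, inner_zero_right, integral_zero]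
  have heT : e T = 0 := by
    simp only [he_def, hT' T hT'T.le, Pi.zero_apply, inner_zero_right, integral_zero]
  have hFTC : ∫ t in Ioo 0 T, e' t = 0 := by
    rw [← integral_Ioc_eq_integral_Ioo, ← intervalIntegral.integral_of_le hT.le,
      intervalIntegral.integral_eq_sub_of_hasDerivAt_of_le hT.le
        (fun t ht => (he t ht).continuousWithinAt)
        (fun t ht => (he t (Ioo_subset_Icc_self ht)).hasDerivAt (Icc_mem_nhds ht.1 ht.2))
        ((he'cont.mono (uIcc_of_le hT.le).subset).intervalIntegrable),
      heT, he0, sub_zero]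
  -- the two sides, continuous in time on `I`
  set A : ℝ → ℝ := fun t => ∫ x, (⟪v t x, FunctionSpaces.Torus.timeDeriv ψ t x⟫_ℝ +
    ⟪v t x, FunctionSpaces.Torus.convect (v t) (ψ t) x⟫_ℝ + p t x * FunctionSpaces.Torus.divergence (ψ t) x) with hA_def
  set B : ℝ → ℝ := fun t => ∫ x, ∑ j, ⟪R t x j, FunctionSpaces.Torus.partialDeriv j (ψ t) x⟫_ℝ with hB_def
  have hAsm : FunctionSpaces.Torus.IsSmoothSpaceTimeOn I (fun t x => ⟪v t x, FunctionSpaces.Torus.timeDeriv ψ t x⟫_ℝ +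
      ⟪v t x, FunctionSpaces.Torus.convect (v t) (ψ t) x⟫_ℝ + p t x * FunctionSpaces.Torus.divergence (ψ t) x) :=
    ((hvI.inner hψ'I).add (hvI.inner (hvI.convect hψI hU))).add (hpI.mul (hψI.divergence hU))
  have hBsm : FunctionSpaces.Torus.IsSmoothSpaceTimeOn I (fun t x => ∑ j, ⟪R t x j, FunctionSpaces.Torus.partialDeriv j (ψ t) x⟫_ℝ) :=
    FunctionSpaces.Torus.IsSmoothSpaceTimeOn.sum fun j _ => (hRI.column j).inner (hψI.partialDeriv hU j)
  have hAint : IntegrableOn A (Ioo 0 T) volume :=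
    ((hAsm.continuousOn_integral (convex_Icc 0 T)).integrableOn_compact isCompact_Icc).mono_set
      Ioo_subset_Icc_self
  have hBint : IntegrableOn B (Ioo 0 T) volume :=
    ((hBsm.continuousOn_integral (convex_Icc 0 T)).integrableOn_compact isCompact_Icc).mono_set
      Ioo_subset_Icc_self
  -- pointwise in time: `e' t = A t - B t` on `(0, T)`
  have hkey : ∀ t ∈ Ioo 0 T, e' t = A t - B t := by
    intro t ht
    have htI : t ∈ I := Ioo_subset_Icc_self ht
    have hvt : FunctionSpaces.Torus.IsSmooth (v t) := hvI.isSmooth_slice htI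
    have hpt : FunctionSpaces.Torus.IsSmooth (p t) := hpI.isSmooth_slice htI
    have hRt : FunctionSpaces.Torus.IsSmooth (R t) := hRI.isSmooth_slice htI
    have hψt : FunctionSpaces.Torus.IsSmooth (ψ t) := hψI.isSmooth_slice htI
    have hψ't : FunctionSpaces.Torus.IsSmooth (FunctionSpaces.Torus.timeDeriv ψ t) := hψ.1.timeDeriv.isSmooth_slice t
    have hslice : ∀ x, FunctionSpaces.Torus.timeDerivWithin I (fun t x => ⟪v t x, ψ t x⟫_ℝ) t x =
        ⟪v t x, FunctionSpaces.Torus.timeDeriv ψ t x⟫_ℝ +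
          ⟪tensorDivergence (R t) x - FunctionSpaces.Torus.gradient (p t) x - FunctionSpaces.Torus.convect (v t) (v t) x, ψ t x⟫_ℝ := by
      intro x
      have h1 : HasDerivWithinAt (fun τ => v τ x) (FunctionSpaces.Torus.timeDerivWithin I v t x) I t :=
        hvI.hasDerivWithinAt_slice htI x
      have h2 : HasDerivWithinAt (fun τ => ψ τ x) (FunctionSpaces.Torus.timeDeriv ψ t x) I t := by
        obtain ⟨y, rfl⟩ := FunctionSpaces.Torus.proj_surjective x
        have hd : Differentiable ℝ (fun τ : ℝ => FunctionSpaces.Torus.stLift ψ (τ, y)) :=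
          (hψs.differentiable (by simp)).comp (differentiable_id.prodMk (differentiable_const y))
        exact (hd t).hasDerivAt.hasDerivWithinAt
      have h12 := (h1.inner ℝ h2).derivWithin (hU t htI)
      rw [FunctionSpaces.Torus.timeDerivWithin, h12, hmomI t htI x]
    have i1 : Integrable (fun x => ⟪v t x, FunctionSpaces.Torus.timeDeriv ψ t x⟫_ℝ) volume :=
      (hvt.inner hψ't).integrable
    have i2 : Integrable (fun x => ⟪v t x, FunctionSpaces.Torus.convect (v t) (ψ t) x⟫_ℝ) volume :=
      (hvt.inner (hvt.convect hψt)).integrable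
    have hs3 : FunctionSpaces.Torus.IsSmooth (fun x => p t x * FunctionSpaces.Torus.divergence (ψ t) x) :=
      ContDiff.mul hpt hψt.divergence
    have i3 : Integrable (fun x => p t x * FunctionSpaces.Torus.divergence (ψ t) x) volume :=
      hs3.integrable
    have iD : Integrable (fun x => ⟪tensorDivergence (R t) x, ψ t x⟫_ℝ) volume :=
      (hRt.tensorDivergence.inner hψt).integrable
    have iG : Integrable (fun x => ⟪FunctionSpaces.Torus.gradient (p t) x, ψ t x⟫_ℝ) volume :=
      (hpt.gradient.inner hψt).integrable
    have iC : Integrable (fun x => ⟪FunctionSpaces.Torus.convect (v t) (v t) x, ψ t x⟫_ℝ) volume :=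
      ((hvt.convect hvt).inner hψt).integrable
    have hgrad : ∫ x, ⟪FunctionSpaces.Torus.gradient (p t) x, ψ t x⟫_ℝ = -∫ x, p t x * FunctionSpaces.Torus.divergence (ψ t) x := by
      rw [← FunctionSpaces.Torus.integral_inner_gradient_eq_neg_integral_mul_divergence_holds hψt hpt]
      exact integral_congr_ae (ae_of_all _ fun x => real_inner_comm _ _)
    have hconv : ∫ x, ⟪FunctionSpaces.Torus.convect (v t) (v t) x, ψ t x⟫_ℝ =
        -∫ x, ⟪v t x, FunctionSpaces.Torus.convect (v t) (ψ t) x⟫_ℝ :=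
      FunctionSpaces.Torus.integral_inner_convect_eq_neg hvt (hdiv t (hS htI)) hvt hψt
    have hdivR : ∫ x, ⟪tensorDivergence (R t) x, ψ t x⟫_ℝ = -B t :=
      integral_inner_tensorDivergence hRt hψt
    have i12 : Integrable (fun x => ⟪v t x, FunctionSpaces.Torus.timeDeriv ψ t x⟫_ℝ +
        ⟪v t x, FunctionSpaces.Torus.convect (v t) (ψ t) x⟫_ℝ) volume := i1.add i2
    have iDG : Integrable (fun x => ⟪tensorDivergence (R t) x, ψ t x⟫_ℝ -
        ⟪FunctionSpaces.Torus.gradient (p t) x, ψ t x⟫_ℝ) volume := iD.sub iG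
    have iDGC : Integrable (fun x => ⟪tensorDivergence (R t) x, ψ t x⟫_ℝ -
        ⟪FunctionSpaces.Torus.gradient (p t) x, ψ t x⟫_ℝ -
        ⟪FunctionSpaces.Torus.convect (v t) (v t) x, ψ t x⟫_ℝ) volume := iDG.sub iC
    simp only [he'_def, hA_def]
    simp_rw [hslice, inner_sub_left]
    rw [integral_add i1 iDGC, integral_sub iDG iC, integral_sub iD iG,
      hgrad, hconv, hdivR, integral_add i12 i3, integral_add i1 i2]
    ring
  -- integrate in time
  have h0 : ∫ t in Ioo 0 T, (A t - B t) = 0 :=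
    (setIntegral_congr_fun measurableSet_Ioo fun t ht => (hkey t ht).symm).trans hFTC
  have h1 : (∫ t in Ioo 0 T, A t) - ∫ t in Ioo 0 T, B t = 0 := by
    rw [← integral_sub hAint hBint, h0]
  exact sub_eq_zero.1 h1

/-! ### The relaxed local energy equality, tested -/

omit [DecidableEq d] in
/-- Additivity of the divergence for `C¹` vector fields on the torus. [folklore] -/
private theorem torusDivergence_fun_add {u w : UnitAddTorus d → EuclideanSpace ℝ d} [DecidableEq d]
    (hu : FunctionSpaces.Torus.IsContDiff 1 u) (hw : FunctionSpaces.Torus.IsContDiff 1 w) (x : UnitAddTorus d) :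
    FunctionSpaces.Torus.divergence (fun y => u y + w y) x = FunctionSpaces.Torus.divergence u x + FunctionSpaces.Torus.divergence w x := by
  unfold FunctionSpaces.Torus.divergence
  rw [← Finset.sum_add_distrib]
  refine Finset.sum_congr rfl fun i _ => ?_
  have hui : FunctionSpaces.Torus.IsContDiff 1 (fun y => u y i) :=
    (EuclideanSpace.proj i : EuclideanSpace ℝ d →L[ℝ] ℝ).contDiff.comp hu
  have hwi : FunctionSpaces.Torus.IsContDiff 1 (fun y => w y i) :=
    (EuclideanSpace.proj i : EuclideanSpace ℝ d →L[ℝ] ℝ).contDiff.comp hw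
  have h := congrFun (FunctionSpaces.Torus.partialDeriv_add hui hwi i) x
  simp only [Pi.add_apply] at h
  rw [← h]
  rfl

/-- **Tested relaxed local energy equality** (De Lellis–Kwon 2022, §2.2; integration by parts
of the third equation of Def. 2.1). Let `v, p, R, κ, φ` be jointly smooth on `S × T^d`,
`S ⊇ [0,T]`, `0 < T`, let `E` be a `C¹` time profile, `div v = 0` on `S`, and assume pointwise
on `S` the relaxed local energy equality
`∂ₜ(½|v|²) + div((½|v|² + p) v) = ∂ₜκ + ⟪v, ∇κ⟫ + ½E' + div(R v) + div φ`
(`Dₜ(κ + E/2) = ∂ₜκ + v·∇κ + E'/2`; `R v = ∑ⱼ vⱼ R^{(j)}` with `R` stored by columns). Then for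
every smooth scalar test `ψ` compactly supported in time in `(0,T)`,
`∫₀ᵀ∫ (½|v|² ∂ₜψ + (½|v|² + p)⟪v, ∇ψ⟫)
   = ∫₀ᵀ∫ (κ ∂ₜψ + κ⟪v, ∇ψ⟫ + (-½E'(t)) ψ + ⟪R v, ∇ψ⟫ + ⟪φ, ∇ψ⟫)`.
Proof: `e(t) = ∫ (½|v|² - κ) ψ` vanishes at `t = 0, T`; its derivative is computed from the
pointwise equation, and all divergence terms are moved onto `ψ`: the integrands of `e'` and of
the difference of the two sides differ by `div (ψ (κ v + R v + φ - (½|v|² + p) v))` (using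
`div v = 0`), whose integral over the torus vanishes. [cite: DelellisKwon2022, Def. 2.1 and §2.2] -/
theorem localEnergy_testedIdentity {S : Set ℝ} {T : ℝ} (hT : 0 < T) (hS : Icc 0 T ⊆ S)
    {v : ℝ → UnitAddTorus d → EuclideanSpace ℝ d} {p : ℝ → UnitAddTorus d → ℝ}
    {R : ℝ → UnitAddTorus d → d → EuclideanSpace ℝ d} {κ : ℝ → UnitAddTorus d → ℝ}
    {φ : ℝ → UnitAddTorus d → EuclideanSpace ℝ d} {E : ℝ → ℝ}
    (hv : FunctionSpaces.Torus.IsSmoothSpaceTimeOn S v) (hp : FunctionSpaces.Torus.IsSmoothSpaceTimeOn S p) (hR : FunctionSpaces.Torus.IsSmoothSpaceTimeOn S R)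
    (hκ : FunctionSpaces.Torus.IsSmoothSpaceTimeOn S κ) (hφ : FunctionSpaces.Torus.IsSmoothSpaceTimeOn S φ) (hE : ContDiff ℝ 1 E)
    (hdiv : ∀ t ∈ S, FunctionSpaces.Torus.IsDivFree (v t))
    (hloc : ∀ t ∈ S, ∀ x,
      FunctionSpaces.Torus.timeDerivWithin S (fun s y => 2⁻¹ * ‖v s y‖ ^ 2) t x +
          FunctionSpaces.Torus.divergence (fun y => (2⁻¹ * ‖v t y‖ ^ 2 + p t y) • v t y) x =
        FunctionSpaces.Torus.timeDerivWithin S κ t x + ⟪v t x, FunctionSpaces.Torus.gradient (κ t) x⟫_ℝ + 2⁻¹ * deriv E t +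
          FunctionSpaces.Torus.divergence (fun y => ∑ j, v t y j • R t y j) x + FunctionSpaces.Torus.divergence (φ t) x)
    {ψ : ℝ → UnitAddTorus d → ℝ} (hψ : FunctionSpaces.Torus.IsSpaceTimeTestIoo T ψ) :
    ∫ t in Ioo 0 T, ∫ x, (2⁻¹ * ‖v t x‖ ^ 2 * FunctionSpaces.Torus.timeDeriv ψ t x +
        (2⁻¹ * ‖v t x‖ ^ 2 + p t x) * ⟪v t x, FunctionSpaces.Torus.gradient (ψ t) x⟫_ℝ) =
      ∫ t in Ioo 0 T, ∫ x, (κ t x * FunctionSpaces.Torus.timeDeriv ψ t x + κ t x * ⟪v t x, FunctionSpaces.Torus.gradient (ψ t) x⟫_ℝ +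
        -(2⁻¹ * deriv E t) * ψ t x + ⟪∑ j, v t x j • R t x j, FunctionSpaces.Torus.gradient (ψ t) x⟫_ℝ +
        ⟪φ t x, FunctionSpaces.Torus.gradient (ψ t) x⟫_ℝ) := by
  obtain ⟨⟨hψs, T', hT'T, hT'⟩, ε, hε, hε0⟩ := id hψ
  set I : Set ℝ := Icc 0 T with hI_def
  have hU : UniqueDiffOn ℝ I := uniqueDiffOn_Icc hT
  -- the kinetic energy density `en = ½|v|²` is jointly smooth
  set en : ℝ → UnitAddTorus d → ℝ := fun s y => 2⁻¹ * ‖v s y‖ ^ 2 with hen_def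
  have hen : FunctionSpaces.Torus.IsSmoothSpaceTimeOn S en := contDiffOn_const.mul (hv.norm_sq ℝ)
  have hvI : FunctionSpaces.Torus.IsSmoothSpaceTimeOn I v := hv.mono hS
  have hpI : FunctionSpaces.Torus.IsSmoothSpaceTimeOn I p := hp.mono hS
  have hRI : FunctionSpaces.Torus.IsSmoothSpaceTimeOn I R := hR.mono hS
  have hκI : FunctionSpaces.Torus.IsSmoothSpaceTimeOn I κ := hκ.mono hS
  have hφI : FunctionSpaces.Torus.IsSmoothSpaceTimeOn I φ := hφ.mono hS
  have henI : FunctionSpaces.Torus.IsSmoothSpaceTimeOn I en := hen.mono hS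
  have hψI : FunctionSpaces.Torus.IsSmoothSpaceTimeOn I ψ := hψs.contDiffOn
  have hψ'I : FunctionSpaces.Torus.IsSmoothSpaceTimeOn I (FunctionSpaces.Torus.timeDeriv ψ) := hψ.1.timeDeriv.1.contDiffOn
  have hE' : Continuous (deriv E) := hE.continuous_deriv le_rfl
  -- the local energy equality with time derivatives within `I`
  have hlocI : ∀ t ∈ I, ∀ x, FunctionSpaces.Torus.timeDerivWithin I en t x - FunctionSpaces.Torus.timeDerivWithin I κ t x =
      -FunctionSpaces.Torus.divergence (fun y => (en t y + p t y) • v t y) x + ⟪v t x, FunctionSpaces.Torus.gradient (κ t) x⟫_ℝ +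
        2⁻¹ * deriv E t + FunctionSpaces.Torus.divergence (fun y => ∑ j, v t y j • R t y j) x + FunctionSpaces.Torus.divergence (φ t) x := by
    intro t ht x
    have h1 : FunctionSpaces.Torus.timeDerivWithin I en t x = FunctionSpaces.Torus.timeDerivWithin S en t x :=
      ((hen.hasDerivWithinAt_slice (hS ht) x).mono hS).derivWithin (hU t ht)
    have h2 : FunctionSpaces.Torus.timeDerivWithin I κ t x = FunctionSpaces.Torus.timeDerivWithin S κ t x :=
      ((hκ.hasDerivWithinAt_slice (hS ht) x).mono hS).derivWithin (hU t ht)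
    have h3 := hloc t (hS ht) x
    rw [h1, h2]
    simp only [hen_def] at h3 ⊢
    linarith
  -- the pairing `e(t) = ∫ (½|v|² - κ) ψ` and its derivative within `I`
  have hg : FunctionSpaces.Torus.IsSmoothSpaceTimeOn I (fun t x => (en t x - κ t x) * ψ t x) := (henI.sub hκI).mul hψI
  set e : ℝ → ℝ := fun t => ∫ x, (en t x - κ t x) * ψ t x with he_def
  set e' : ℝ → ℝ := fun t => ∫ x, FunctionSpaces.Torus.timeDerivWithin I (fun t x => (en t x - κ t x) * ψ t x) t x
    with he'_def
  have he : ∀ t ∈ I, HasDerivWithinAt e (e' t) I t := fun t ht =>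
    hg.hasDerivWithinAt_integral (convex_Icc 0 T) ht
  have he'cont : ContinuousOn e' I := hg.continuousOn_integral_timeDerivWithin hU
  have he0 : e 0 = 0 := by
    simp only [he_def, hε0 0 hε.le, Pi.zero_apply, mul_zero, integral_zero]
  have heT : e T = 0 := by
    simp only [he_def, hT' T hT'T.le, Pi.zero_apply, mul_zero, integral_zero]
  have hFTC : ∫ t in Ioo 0 T, e' t = 0 := by
    rw [← integral_Ioc_eq_integral_Ioo, ← intervalIntegral.integral_of_le hT.le,
      intervalIntegral.integral_eq_sub_of_hasDerivAt_of_le hT.le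
        (fun t ht => (he t ht).continuousWithinAt)
        (fun t ht => (he t (Ioo_subset_Icc_self ht)).hasDerivAt (Icc_mem_nhds ht.1 ht.2))
        ((he'cont.mono (uIcc_of_le hT.le).subset).intervalIntegrable),
      heT, he0, sub_zero]
  -- the two sides, continuous in time on `I`
  set A : ℝ → ℝ := fun t => ∫ x, (2⁻¹ * ‖v t x‖ ^ 2 * FunctionSpaces.Torus.timeDeriv ψ t x +
    (2⁻¹ * ‖v t x‖ ^ 2 + p t x) * ⟪v t x, FunctionSpaces.Torus.gradient (ψ t) x⟫_ℝ) with hA_def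
  set B : ℝ → ℝ := fun t => ∫ x, (κ t x * FunctionSpaces.Torus.timeDeriv ψ t x + κ t x * ⟪v t x, FunctionSpaces.Torus.gradient (ψ t) x⟫_ℝ +
    -(2⁻¹ * deriv E t) * ψ t x + ⟪∑ j, v t x j • R t x j, FunctionSpaces.Torus.gradient (ψ t) x⟫_ℝ +
    ⟪φ t x, FunctionSpaces.Torus.gradient (ψ t) x⟫_ℝ) with hB_def
  have hgradI : FunctionSpaces.Torus.IsSmoothSpaceTimeOn I (fun t => FunctionSpaces.Torus.gradient (ψ t)) := hψI.gradient hU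
  have hAsm : FunctionSpaces.Torus.IsSmoothSpaceTimeOn I (fun t x => 2⁻¹ * ‖v t x‖ ^ 2 * FunctionSpaces.Torus.timeDeriv ψ t x +
      (2⁻¹ * ‖v t x‖ ^ 2 + p t x) * ⟪v t x, FunctionSpaces.Torus.gradient (ψ t) x⟫_ℝ) :=
    (henI.mul hψ'I).add ((henI.add hpI).mul (hvI.inner hgradI))
  have hRvI : FunctionSpaces.Torus.IsSmoothSpaceTimeOn I (fun t x => ∑ j, v t x j • R t x j) :=
    FunctionSpaces.Torus.IsSmoothSpaceTimeOn.sum fun j _ => (hvI.apply j).smul (hRI.column j)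
  have hBcont : ContinuousOn B I := by
    refine FunctionSpaces.Torus.continuousOn_integral_of_continuousOn_stLift ?_
    have hc1 := ((hκI.mul hψ'I).add (hκI.mul (hvI.inner hgradI))).continuousOn_stLift
    have hc2 : ContinuousOn (FunctionSpaces.Torus.stLift fun t x => -(2⁻¹ * deriv E t) * ψ t x) (I ×ˢ univ) :=
      (((continuous_const.mul hE').neg.comp continuous_fst).mul hψs.continuous).continuousOn
    have hc3 := ((hRvI.inner hgradI).add (hφI.inner hgradI)).continuousOn_stLift
    have h := (hc1.add hc2).add hc3
    refine h.congr fun z _ => ?_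
    simp only [FunctionSpaces.Torus.stLift, Pi.add_apply]
    ring
  have hAint : IntegrableOn A (Ioo 0 T) volume :=
    ((hAsm.continuousOn_integral (convex_Icc 0 T)).integrableOn_compact isCompact_Icc).mono_set
      Ioo_subset_Icc_self
  have hBint : IntegrableOn B (Ioo 0 T) volume :=
    (hBcont.integrableOn_compact isCompact_Icc).mono_set Ioo_subset_Icc_self
  -- pointwise in time: `e' t = A t - B t` on `(0, T)`
  have hkey : ∀ t ∈ Ioo 0 T, e' t = A t - B t := by
    intro t ht
    have htI : t ∈ I := Ioo_subset_Icc_self ht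
    have hvt : FunctionSpaces.Torus.IsSmooth (v t) := hvI.isSmooth_slice htI
    have hpt : FunctionSpaces.Torus.IsSmooth (p t) := hpI.isSmooth_slice htI
    have hRt : FunctionSpaces.Torus.IsSmooth (R t) := hRI.isSmooth_slice htI
    have hκt : FunctionSpaces.Torus.IsSmooth (κ t) := hκI.isSmooth_slice htI
    have hφt : FunctionSpaces.Torus.IsSmooth (φ t) := hφI.isSmooth_slice htI
    have hent : FunctionSpaces.Torus.IsSmooth (en t) := henI.isSmooth_slice htI
    have hψt : FunctionSpaces.Torus.IsSmooth (ψ t) := hψI.isSmooth_slice htI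
    have hψ't : FunctionSpaces.Torus.IsSmooth (FunctionSpaces.Torus.timeDeriv ψ t) := hψ.1.timeDeriv.isSmooth_slice t
    have hRvt : FunctionSpaces.Torus.IsSmooth (fun y => ∑ j, v t y j • R t y j) := hRvI.isSmooth_slice htI
    have hGt : FunctionSpaces.Torus.IsSmooth (fun y => (en t y + p t y) • v t y) := (hent.add hpt).smul' hvt
    have hκvt : FunctionSpaces.Torus.IsSmooth (fun y => κ t y • v t y) := hκt.smul' hvt
    -- the time derivative of the paired density
    have hslice : ∀ x, FunctionSpaces.Torus.timeDerivWithin I (fun t x => (en t x - κ t x) * ψ t x) t x =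
        (-FunctionSpaces.Torus.divergence (fun y => (en t y + p t y) • v t y) x + ⟪v t x, FunctionSpaces.Torus.gradient (κ t) x⟫_ℝ +
          2⁻¹ * deriv E t + FunctionSpaces.Torus.divergence (fun y => ∑ j, v t y j • R t y j) x +
          FunctionSpaces.Torus.divergence (φ t) x) * ψ t x + (en t x - κ t x) * FunctionSpaces.Torus.timeDeriv ψ t x := by
      intro x
      have h1 : HasDerivWithinAt (fun τ => en τ x) (FunctionSpaces.Torus.timeDerivWithin I en t x) I t :=
        henI.hasDerivWithinAt_slice htI x
      have h2 : HasDerivWithinAt (fun τ => κ τ x) (FunctionSpaces.Torus.timeDerivWithin I κ t x) I t :=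
        hκI.hasDerivWithinAt_slice htI x
      have h3 : HasDerivWithinAt (fun τ => ψ τ x) (FunctionSpaces.Torus.timeDeriv ψ t x) I t := by
        obtain ⟨y, rfl⟩ := FunctionSpaces.Torus.proj_surjective x
        have hd : Differentiable ℝ (fun τ : ℝ => FunctionSpaces.Torus.stLift ψ (τ, y)) :=
          (hψs.differentiable (by simp)).comp (differentiable_id.prodMk (differentiable_const y))
        exact (hd t).hasDerivAt.hasDerivWithinAt
      have h123 := ((h1.fun_sub h2).fun_mul h3).derivWithin (hU t htI)
      rw [FunctionSpaces.Torus.timeDerivWithin, h123, hlocI t htI x]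
    -- the divergence remainder `div (ψ X)`, `X = κ v + R v + φ - (½|v|² + p) v`
    set X : UnitAddTorus d → EuclideanSpace ℝ d := fun y =>
      κ t y • v t y + ∑ j, v t y j • R t y j + φ t y + -((en t y + p t y) • v t y) with hX_def
    have hA2 : FunctionSpaces.Torus.IsSmooth (fun y => κ t y • v t y + ∑ j, v t y j • R t y j) :=
      hκvt.add hRvt
    have hA3 : FunctionSpaces.Torus.IsSmooth (fun y => κ t y • v t y + ∑ j, v t y j • R t y j + φ t y) :=
      hA2.add hφt
    have hGn : FunctionSpaces.Torus.IsSmooth (fun y => -((en t y + p t y) • v t y)) := hGt.neg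
    have hXs : FunctionSpaces.Torus.IsSmooth X := hA3.add hGn
    have hX1 : FunctionSpaces.Torus.IsContDiff 1 X := hXs.isContDiff (by simp)
    have hψ1 : FunctionSpaces.Torus.IsContDiff 1 (ψ t) := hψt.isContDiff (by simp)
    have hdivX : ∀ x, FunctionSpaces.Torus.divergence X x = ⟪v t x, FunctionSpaces.Torus.gradient (κ t) x⟫_ℝ +
        FunctionSpaces.Torus.divergence (fun y => ∑ j, v t y j • R t y j) x + FunctionSpaces.Torus.divergence (φ t) x +
        -FunctionSpaces.Torus.divergence (fun y => (en t y + p t y) • v t y) x := by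
      intro x
      have hneg : (fun y => -((en t y + p t y) • v t y)) =
          (-1 : ℝ) • fun y => (en t y + p t y) • v t y := by
        funext y; simp
      rw [hX_def, torusDivergence_fun_add (hA3.isContDiff (by simp)) (hGn.isContDiff (by simp)),
        torusDivergence_fun_add (hA2.isContDiff (by simp)) (hφt.isContDiff (by simp)),
        torusDivergence_fun_add (hκvt.isContDiff (by simp)) (hRvt.isContDiff (by simp)),
        divergence_smul (hκt.isContDiff (by simp)) (hvt.isContDiff (by simp)), hdiv t (hS htI) x,
        mul_zero, add_zero, hneg, divergence_const_smul (hGt.isContDiff (by simp))]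
      ring
    have hdivW : ∀ x, FunctionSpaces.Torus.divergence (fun y => ψ t y • X y) x =
        ⟪X x, FunctionSpaces.Torus.gradient (ψ t) x⟫_ℝ + ψ t x * FunctionSpaces.Torus.divergence X x := fun x =>
      divergence_smul hψ1 hX1 x
    have hXinner : ∀ x, ⟪X x, FunctionSpaces.Torus.gradient (ψ t) x⟫_ℝ = κ t x * ⟪v t x, FunctionSpaces.Torus.gradient (ψ t) x⟫_ℝ +
        ⟪∑ j, v t x j • R t x j, FunctionSpaces.Torus.gradient (ψ t) x⟫_ℝ + ⟪φ t x, FunctionSpaces.Torus.gradient (ψ t) x⟫_ℝ +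
        -((en t x + p t x) * ⟪v t x, FunctionSpaces.Torus.gradient (ψ t) x⟫_ℝ) := by
      intro x
      simp only [hX_def, inner_add_left, inner_neg_left, real_inner_smul_left]
    -- pointwise: `∂ₜ((½|v|² - κ)ψ) = a - b + div (ψ X)`
    have hpt : ∀ x, FunctionSpaces.Torus.timeDerivWithin I (fun t x => (en t x - κ t x) * ψ t x) t x =
        (2⁻¹ * ‖v t x‖ ^ 2 * FunctionSpaces.Torus.timeDeriv ψ t x +
            (2⁻¹ * ‖v t x‖ ^ 2 + p t x) * ⟪v t x, FunctionSpaces.Torus.gradient (ψ t) x⟫_ℝ) -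
          (κ t x * FunctionSpaces.Torus.timeDeriv ψ t x + κ t x * ⟪v t x, FunctionSpaces.Torus.gradient (ψ t) x⟫_ℝ +
            -(2⁻¹ * deriv E t) * ψ t x + ⟪∑ j, v t x j • R t x j, FunctionSpaces.Torus.gradient (ψ t) x⟫_ℝ +
            ⟪φ t x, FunctionSpaces.Torus.gradient (ψ t) x⟫_ℝ) +
          FunctionSpaces.Torus.divergence (fun y => ψ t y • X y) x := by
      intro x
      rw [hslice x, hdivW x, hXinner x, hdivX x]
      simp only [hen_def]
      ring
    have iA : Integrable (fun x => 2⁻¹ * ‖v t x‖ ^ 2 * FunctionSpaces.Torus.timeDeriv ψ t x +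
        (2⁻¹ * ‖v t x‖ ^ 2 + p t x) * ⟪v t x, FunctionSpaces.Torus.gradient (ψ t) x⟫_ℝ) volume :=
      (hAsm.isSmooth_slice htI).integrable
    have iB : Integrable (fun x => κ t x * FunctionSpaces.Torus.timeDeriv ψ t x + κ t x * ⟪v t x, FunctionSpaces.Torus.gradient (ψ t) x⟫_ℝ +
        -(2⁻¹ * deriv E t) * ψ t x + ⟪∑ j, v t x j • R t x j, FunctionSpaces.Torus.gradient (ψ t) x⟫_ℝ +
        ⟪φ t x, FunctionSpaces.Torus.gradient (ψ t) x⟫_ℝ) volume := by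
      have h1 : FunctionSpaces.Torus.IsSmooth (fun x => κ t x * FunctionSpaces.Torus.timeDeriv ψ t x + κ t x * ⟪v t x, FunctionSpaces.Torus.gradient (ψ t) x⟫_ℝ) :=
        (ContDiff.mul hκt hψ't).add (ContDiff.mul hκt (hvt.inner hψt.gradient))
      have h2 : FunctionSpaces.Torus.IsSmooth (fun x => -(2⁻¹ * deriv E t) * ψ t x) := ContDiff.mul contDiff_const hψt
      have h3 : FunctionSpaces.Torus.IsSmooth (fun x => ⟪∑ j, v t x j • R t x j, FunctionSpaces.Torus.gradient (ψ t) x⟫_ℝ +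
          ⟪φ t x, FunctionSpaces.Torus.gradient (ψ t) x⟫_ℝ) :=
        (hRvt.inner hψt.gradient).add (hφt.inner hψt.gradient)
      have h := (h1.integrable.add h2.integrable).add h3.integrable
      refine h.congr (ae_of_all _ fun x => ?_)
      simp only [Pi.add_apply]
      ring
    have iW : Integrable (fun x => FunctionSpaces.Torus.divergence (fun y => ψ t y • X y) x) volume :=
      (hψt.smul' hXs).divergence.integrable
    have hW0 : ∫ x, FunctionSpaces.Torus.divergence (fun y => ψ t y • X y) x = 0 :=
      FunctionSpaces.Torus.integral_divergence_eq_zero_holds (hψt.smul' hXs)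
    have iAB := iA.sub iB
    simp only [Pi.sub_def] at iAB
    simp only [he'_def, hA_def, hB_def]
    simp_rw [hpt]
    rw [integral_add iAB iW, integral_sub iA iB, hW0, add_zero]
  -- integrate in time
  have h0 : ∫ t in Ioo 0 T, (A t - B t) = 0 :=
    (setIntegral_congr_fun measurableSet_Ioo fun t ht => (hkey t ht).symm).trans hFTC
  have h1 : (∫ t in Ioo 0 T, A t) - ∫ t in Ioo 0 T, B t = 0 := by
    rw [← integral_sub hAint hBint, h0]
  exact sub_eq_zero.1 h1

end Literature.Analysis.FluidPDE.Torus
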